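import Mathlib
import Summits.PneNP.PneNP.Theses.RamseyUncertifiable
import Summits.PneNP.PneNP.Theorems.RamseyNotNP.Negative.Sandwich
import Summits.PneNP.PneNP.Theorems.RamseyUncertifiableRamseyNotNPTypicalCapture
import Literature.Computability.MetaComplexity.ProofSystems
import Literature.Computability.MetaComplexity.ProofSystemsProofs
import Literature.Computability.Complexity.ProofComplexity
import Literature.Computability.Complexity.ProofComplexityNP

/-!
# `RamseyNotNP` (stmt-PneNP-9814) in Cook–Reckhow form, and where it sits among the proof-complexity cruxes

`X = Summit.PneNP.PneNP.Theses.RamseyUncertifiable.RamseyNotNP` says that the language RAMSEY₂ of adjacency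
codes of graphs on `Fin n` with neither a clique nor an independent set of size `⌈2 log₂ n⌉ = Nat.clog 2 (n²)` is
not in `NP`.  The route's slogan is "Ramsey-ness has no polynomial-size certificates, FOR ANY VERIFIER"; this
helper file (line `Sketch`, re-audit lead c2) lands that reading and the resulting placement of the crux as
importable theorems over the tree's Cook–Reckhow vocabulary (`Literature.Computability.MetaComplexity.ProofSystems`):

* `ramseyNotNP_iff_not_hasPolyBoundedProofSystem` — **X ⟺ RAMSEY₂ has no polynomially bounded Cook–Reckhow
  proof system** (Cook–Reckhow 1979, Prop. 1.4, tree fact `hasPolyBoundedProofSystem_iff_mem_NP_holds`);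
* `ramseyNotNP_iff_forall_not_isPolyBounded` — equivalently, **every** proof system for RAMSEY₂ ("Ramsey
  certifier") fails to be polynomially bounded: the universal quantifier over verifiers that distinguishes the
  crux from each rung of the route's ladder (resolution, regular resolution, constant-level Lasserre), which
  bound ONE certifier each;
* `not_hasPolyBoundedProofSystem_TAUT_of_ramseyNotNP` — **X ⟹ TAUT has no polynomially bounded proof
  system**, i.e. the crux implies, verbatim, the thesis `¬ HasPolyBoundedProofSystem TAUT` of route
  `PneNP/ProofCplx` (item stmt-PneNP-0097, `ProofcplxThesis`; Cook–Reckhow 1979 Prop. 1.1, tree fact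
  `NP_eq_coNP_iff_hasPolyBoundedProofSystem_TAUT_holds`, composed with the landed
  `Negative.coNP_ne_NP_of_ramseyNotNP`): stmt-PneNP-9814 is at least as strong as stmt-PneNP-0097;
* `not_isPolyBounded_of_typicalCliqueCapture`, `not_hasPolyBoundedProofSystem_TAUT_of_typicalCliqueCapture` —
  the same two consequences for the line's one open stub D = TCC (`stub_typicalCliqueCapture`, stated INLINE,
  verbatim the registered signature), through the landed capture `TypicalCapture.ramseyNotNP_of_typicalCliqueCapture`
  (p88147): the stub, like the crux, is a statement of `NP ≠ coNP` strength.

No new definitions; no `sorry`; the open hypotheses (X, TCC) appear only as explicit hypotheses of conditional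
theorems.  Sources: Cook–Reckhow 1979 §1 (Prop. 1.1, 1.4); Krajíček 2019 Thm. 1.1.3; Erdős 1947.
-/

set_option linter.dupNamespace false

namespace Summit.PneNP.PneNP.Theorems.RamseyNotNP.ProofSystemForm

open Finset
open Literature.Computability.Complexity Literature.Computability.MetaComplexity
open Summit.PneNP.PneNP.Theses.RamseyUncertifiable (RamseyNotNP)
open Summit.PneNP.PneNP.Theorems.RamseyNotNP.Negative (coNP_ne_NP_of_ramseyNotNP)
open Summit.PneNP.PneNP.Theorems.RamseyNotNP.TypicalCapture (ramseyNotNP_of_typicalCliqueCapture)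

noncomputable section
open scoped Classical

/-! ### The crux in Cook–Reckhow form -/

/-- **X ⟺ RAMSEY₂ has no polynomially bounded proof system.** By Cook–Reckhow's theorem in general form
(a language has a polynomially bounded proof system iff it is in `NP`, tree fact
`hasPolyBoundedProofSystem_iff_mem_NP_holds`), the crux `RAMSEY₂ ∉ NP` is exactly the statement that no
Cook–Reckhow proof system for Ramsey-ness at the Erdős threshold has polynomial-size proofs of every member.
[cite: CookReckhow1979, §1 Prop. 1.4] -/
theorem ramseyNotNP_iff_not_hasPolyBoundedProofSystem :
    RamseyNotNP ↔
      ¬ HasPolyBoundedProofSystem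
        (encodingGraph.toLanguage {p : Σ n, SimpleGraph (Fin n) |
          p.2.CliqueFree (Nat.clog 2 (p.1 ^ 2)) ∧ p.2ᶜ.CliqueFree (Nat.clog 2 (p.1 ^ 2))}) := by
  unfold Summit.PneNP.PneNP.Theses.RamseyUncertifiable.RamseyNotNP
  have h : HasPolyBoundedProofSystem
      (encodingGraph.toLanguage {p : Σ n, SimpleGraph (Fin n) |
        p.2.CliqueFree (Nat.clog 2 (p.1 ^ 2)) ∧ p.2ᶜ.CliqueFree (Nat.clog 2 (p.1 ^ 2))}) ↔
      encodingGraph.toLanguage {p : Σ n, SimpleGraph (Fin n) |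
        p.2.CliqueFree (Nat.clog 2 (p.1 ^ 2)) ∧ p.2ᶜ.CliqueFree (Nat.clog 2 (p.1 ^ 2))} ∈ Nondeterministic.NP :=
    hasPolyBoundedProofSystem_iff_mem_NP_holds
  exact h.not.symm

/-- **X ⟺ every Ramsey certifier is not polynomially bounded.** The crux quantifies over ALL verifiers: for
every Cook–Reckhow proof system `V` for RAMSEY₂, infinitely many Ramsey graphs have only super-polynomially
long `V`-proofs of their Ramsey-ness.  (Each rung of the route's ladder — resolution, regular resolution,
constant-level Lasserre — is the instance of the right-hand side at ONE `V`.) [cite: CookReckhow1979, §1 Prop. 1.4] -/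
theorem ramseyNotNP_iff_forall_not_isPolyBounded :
    RamseyNotNP ↔
      ∀ V : List Bool → List Bool → Bool,
        IsProofSystemFor V
          (encodingGraph.toLanguage {p : Σ n, SimpleGraph (Fin n) |
            p.2.CliqueFree (Nat.clog 2 (p.1 ^ 2)) ∧ p.2ᶜ.CliqueFree (Nat.clog 2 (p.1 ^ 2))}) →
        ¬ IsPolyBounded V := by
  rw [ramseyNotNP_iff_not_hasPolyBoundedProofSystem]
  unfold HasPolyBoundedProofSystem
  constructor
  · intro h V hV hb
    exact h ⟨V, hV, hb⟩
  · rintro h ⟨V, hV, hb⟩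
    exact h V hV hb

/-- **X makes every Ramsey certifier hard** (the `→` direction, as a usable lemma). [cite: CookReckhow1979, §1 Prop. 1.4] -/
theorem not_isPolyBounded_of_ramseyNotNP (hX : RamseyNotNP) {V : List Bool → List Bool → Bool}
    (hV : IsProofSystemFor V
      (encodingGraph.toLanguage {p : Σ n, SimpleGraph (Fin n) |
        p.2.CliqueFree (Nat.clog 2 (p.1 ^ 2)) ∧ p.2ᶜ.CliqueFree (Nat.clog 2 (p.1 ^ 2))})) :
    ¬ IsPolyBounded V :=
  ramseyNotNP_iff_forall_not_isPolyBounded.1 hX V hV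

/-! ### Placement: the crux implies the thesis of route `ProofCplx` -/

/-- **X ⟹ TAUT has no polynomially bounded proof system** — verbatim the thesis
`¬ HasPolyBoundedProofSystem TAUT` of route `PneNP/ProofCplx` (item stmt-PneNP-0097 `ProofcplxThesis`), i.e.
`NP ≠ coNP` in Cook–Reckhow's form (Prop. 1.1, tree fact `NP_eq_coNP_iff_hasPolyBoundedProofSystem_TAUT_holds`):
a polynomially bounded proof system for `TAUT` gives `NP = coNP`, contradicting the landed
`Negative.coNP_ne_NP_of_ramseyNotNP` (RAMSEY₂ ∈ coNP, support `RamseyInCoNP`).  So stmt-PneNP-9814 is at least as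
strong as stmt-PneNP-0097. [cite: CookReckhow1979, §1 Prop. 1.1] -/
theorem not_hasPolyBoundedProofSystem_TAUT_of_ramseyNotNP (hX : RamseyNotNP) :
    ¬ HasPolyBoundedProofSystem TAUT := by
  intro h
  have hCR : Nondeterministic.NP = coNP ↔ HasPolyBoundedProofSystem TAUT :=
    NP_eq_coNP_iff_hasPolyBoundedProofSystem_TAUT_holds
  exact coNP_ne_NP_of_ramseyNotNP hX (hCR.2 h).symm

/-! ### The same placement for the line's open stub D = TCC -/

/-- **TCC makes every Ramsey certifier hard.** The open stub D of line `Sketch` (`stub_typicalCliqueCapture`,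
verbatim, as the inline hypothesis `hD`: every `NP` language of graph codes all of whose members are
`⌈2log₂n⌉`-clique-free misses a constant fraction of all graphs on `Fin n` infinitely often) implies, through the
landed capture `TypicalCapture.ramseyNotNP_of_typicalCliqueCapture` (TCC ⟹ X), that no proof system for RAMSEY₂
is polynomially bounded.  CONDITIONAL on TCC. [cite: CookReckhow1979, §1 Prop. 1.4] -/
theorem not_isPolyBounded_of_typicalCliqueCapture
    (hD : ∀ S : Set (Σ n, SimpleGraph (Fin n)),
      encodingGraph.toLanguage S ∈ Nondeterministic.NP →
      S ⊆ {p | p.2.CliqueFree (Nat.clog 2 (p.1 ^ 2))} →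
      ∃ c : ℝ, 0 < c ∧ ∀ n₀ : ℕ, ∃ n ≥ n₀,
        ((univ.filter fun G : SimpleGraph (Fin n) => (⟨n, G⟩ : Σ m, SimpleGraph (Fin m)) ∈ S).card : ℝ) ≤
          (1 - c) * Fintype.card (SimpleGraph (Fin n)))
    {V : List Bool → List Bool → Bool}
    (hV : IsProofSystemFor V
      (encodingGraph.toLanguage {p : Σ n, SimpleGraph (Fin n) |
        p.2.CliqueFree (Nat.clog 2 (p.1 ^ 2)) ∧ p.2ᶜ.CliqueFree (Nat.clog 2 (p.1 ^ 2))})) :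
    ¬ IsPolyBounded V :=
  not_isPolyBounded_of_ramseyNotNP (ramseyNotNP_of_typicalCliqueCapture hD) hV

/-- **TCC ⟹ TAUT has no polynomially bounded proof system** (`NP ≠ coNP` in Cook–Reckhow form; the thesis of
route `PneNP/ProofCplx`, stmt-PneNP-0097, verbatim): the line's one open stub is itself a statement of
`NP ≠ coNP` strength — the kernel-checked reason line `Sketch` cannot be completed short of separating `NP`
from `coNP`.  CONDITIONAL on TCC. [cite: CookReckhow1979, §1 Prop. 1.1] -/
theorem not_hasPolyBoundedProofSystem_TAUT_of_typicalCliqueCapture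
    (hD : ∀ S : Set (Σ n, SimpleGraph (Fin n)),
      encodingGraph.toLanguage S ∈ Nondeterministic.NP →
      S ⊆ {p | p.2.CliqueFree (Nat.clog 2 (p.1 ^ 2))} →
      ∃ c : ℝ, 0 < c ∧ ∀ n₀ : ℕ, ∃ n ≥ n₀,
        ((univ.filter fun G : SimpleGraph (Fin n) => (⟨n, G⟩ : Σ m, SimpleGraph (Fin m)) ∈ S).card : ℝ) ≤
          (1 - c) * Fintype.card (SimpleGraph (Fin n))) :
    ¬ HasPolyBoundedProofSystem TAUT :=
  not_hasPolyBoundedProofSystem_TAUT_of_ramseyNotNP (ramseyNotNP_of_typicalCliqueCapture hD)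

end

end Summit.PneNP.PneNP.Theorems.RamseyNotNP.ProofSystemForm
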